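import Mathlib
import HarnessLib
import Literature.MathematicalPhysics.QuantumFieldTheory.GaussianCovarianceComparisonTrace
import Literature.MathematicalPhysics.QuantumFieldTheory.GaussianCovarianceComparisonVector

/-!
# `‖E_{N(0,S₁)} H − E_{N(0,S₀)} H‖ ≤ 8q·h·‖H‖_{L^p(N(0,S₀))}` for BANACH-valued `H`, `h` the Hilbert–Schmidt
# size of the covariance change ([Buc16] Thm 4.5 / [ABKM19] Thm 6.2, `ℓ = 1`, dimension-free form)

`GaussianCovarianceComparisonTrace.abs_integral_multivariateGaussian_sub_le_of_trace` compares the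
expectations of a REAL `L^p` functional under two centred Gaussians whose covariances are close in
Hilbert–Schmidt sense, with a constant independent of the dimension.  The renormalisation-group
application ([ABKM19] Lemma 8.4 with `ℓ = 1`, per-polymer and volume-uniform) integrates the multilinear
forms `D^s K(φ + ζ)`, i.e. Banach-valued functionals; this file transports the real estimate by duality,
exactly as `GaussianCovarianceComparisonVector` does for the crude estimate:

* **`norm_integral_multivariateGaussian_sub_le_of_trace`** — for `S₀, S₁ ≻ 0` with
  `tr((1 − S₀S₁⁻¹)²) ≤ h²`, `0 ≤ h ≤ 1/(4q)`, `p, q` Hölder conjugate, `H ∈ L^p(N(0,S₀))` Banach-valued and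
  `N(0,S₁)`-integrable: `‖∫ H dN(0,S₁) − ∫ H dN(0,S₀)‖ ≤ 8 q h · (∫ ‖H‖^p dN(0,S₀))^{1/p}`;
* **`norm_integral_multivariateGaussian_sub_le_of_trace_chain`** — the telescoped form along a finite chain
  of covariances with consecutive Hilbert–Schmidt sizes `h_j ≤ 1/(4q)`: `≤ 8 q (Σ h_j) N_p`, which removes the
  smallness of the TOTAL change (cut the segment between two covariances into `m` pieces).

Everything is proved; no named fact.

## References
* S. Buchholz, J. Funct. Anal. 275 (2018), Thm 4.5 [Buchholz2016].
* S. Adams, S. Buchholz, R. Kotecký, S. Müller, arXiv:1910.13564, Theorem 6.2, Lemma 8.4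
  [AdamsBuchholzKoteckyMuller2019].
-/

noncomputable section

namespace Literature.MathematicalPhysics.QuantumFieldTheory

open MeasureTheory ProbabilityTheory Matrix
open scoped ENNReal NNReal MatrixOrder

variable {ι : Type*} [Fintype ι] [DecidableEq ι]

/-- **Two non-degenerate centred Gaussians, close in Hilbert–Schmidt sense, have close expectations of
Banach-valued `L^p` functionals — dimension-free constant** ([Buc16] Thm 4.5 / [ABKM19] Thm 6.2; the form
consumed by [ABKM19] Lemma 8.4 with `ℓ = 1`).  Let `S₀, S₁ ≻ 0` with `tr((S₀(S₀⁻¹ − S₁⁻¹))²) ≤ h²`,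
`0 ≤ h ≤ 1/(4q)`, `p, q` Hölder conjugate, `H ∈ L^p(N(0,S₀))` with values in a Banach space and
`N(0,S₁)`-integrable.  Then `‖∫ H dN(0,S₁) − ∫ H dN(0,S₀)‖ ≤ 8 q h · (∫ ‖H‖^p dN(0,S₀))^{1/p}`.
Proof: pair with `f` of norm `≤ 1`, apply the real estimate to `f ∘ H`, and `‖f ∘ H‖_{L^p} ≤ ‖f‖ ‖H‖_{L^p}`.
[cite: Buchholz2016, Thm 4.5] -/
theorem norm_integral_multivariateGaussian_sub_le_of_trace {S₀ S₁ : Matrix ι ι ℝ} (hS₀ : S₀.PosDef)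
    (hS₁ : S₁.PosDef) {h : ℝ} (hh0 : 0 ≤ h)
    (htr : ((S₀ * (S₀⁻¹ - S₁⁻¹)) * (S₀ * (S₀⁻¹ - S₁⁻¹))).trace ≤ h ^ 2)
    {p q : ℝ} (hpq : p.HolderConjugate q) (hhq : h ≤ 1 / (4 * q))
    {F : Type*} [NormedAddCommGroup F] [NormedSpace ℝ F] [CompleteSpace F]
    {H : EuclideanSpace ℝ ι → F} (hH : MemLp H (ENNReal.ofReal p) (multivariateGaussian 0 S₀))
    (hH₁ : Integrable H (multivariateGaussian 0 S₁)) :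
    ‖∫ y, H y ∂(multivariateGaussian 0 S₁) - ∫ y, H y ∂(multivariateGaussian 0 S₀)‖ ≤
      8 * q * h * (∫ y, ‖H y‖ ^ p ∂(multivariateGaussian 0 S₀)) ^ (1 / p) := by
  set μ := multivariateGaussian 0 S₀ with hμ
  have hp1 : 1 < p := hpq.lt
  have hp0 : 0 < p := by linarith
  have hq0 : 0 < q := by linarith [hpq.symm.lt]
  have hpE : ENNReal.ofReal p ≠ 0 := by simp [hp0]
  have hHint : Integrable H μ := hH.integrable (by
    rw [← ENNReal.ofReal_one]; exact ENNReal.ofReal_le_ofReal hp1.le)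
  have hnormp : Integrable (fun y => ‖H y‖ ^ p) μ := by
    have h := hH.integrable_norm_rpow hpE ENNReal.ofReal_ne_top
    rw [ENNReal.toReal_ofReal hp0.le] at h
    exact h
  have hK0 : 0 ≤ 8 * q * h * (∫ y, ‖H y‖ ^ p ∂μ) ^ (1 / p) :=
    mul_nonneg (by positivity) (Real.rpow_nonneg (integral_nonneg fun y => by positivity) _)
  refine NormedSpace.norm_le_dual_bound ℝ _ hK0 fun f => ?_
  rw [dual_apply_integral_sub f hH₁ hHint]
  -- the real estimate for `f ∘ H`
  have hfH : MemLp (fun y => f (H y)) (ENNReal.ofReal p) μ :=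
    ContinuousLinearMap.comp_memLp' f hH
  have hreal := abs_integral_multivariateGaussian_sub_le_of_trace hS₀ hS₁ hh0 htr hpq hhq hfH
  rw [Real.norm_eq_abs]
  refine hreal.trans ?_
  have hroot := rpow_integral_abs_dual_apply_le (μ := μ) f hp0 hnormp
  have h8 : 0 ≤ 8 * q * h := by positivity
  calc 8 * q * h * (∫ y, |f (H y)| ^ p ∂μ) ^ (1 / p)
      ≤ 8 * q * h * (‖f‖ * (∫ y, ‖H y‖ ^ p ∂μ) ^ (1 / p)) := mul_le_mul_of_nonneg_left hroot h8
    _ = 8 * q * h * (∫ y, ‖H y‖ ^ p ∂μ) ^ (1 / p) * ‖f‖ := by ring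


/-- **Chain (telescoping) form**, removing the smallness `h ≤ 1/(4q)` on the total change: for a finite
chain of positive definite covariances `S 0, S 1, …, S m` whose CONSECUTIVE members are Hilbert–Schmidt
close (`tr((S_j(S_j⁻¹ − S_{j+1}⁻¹))²) ≤ h_j²`, `0 ≤ h_j ≤ 1/(4q)`), and a Banach-valued `H` with
`H ∈ L^p(N(0,S_j))` and `(∫ ‖H‖^p dN(0,S_j))^{1/p} ≤ N_p` for every `j`:
`‖∫ H dN(0,S_m) − ∫ H dN(0,S_0)‖ ≤ 8 q (Σ_{j<m} h_j) N_p`.  (In the renormalisation-group application the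
chain is the segment between two step covariances cut into `m` equal pieces, so `Σ h_j` is the total
Hilbert–Schmidt size and no smallness of it is needed.) [cite: Buchholz2016, Thm 4.5] -/
theorem norm_integral_multivariateGaussian_sub_le_of_trace_chain (S : ℕ → Matrix ι ι ℝ)
    (hS : ∀ j, (S j).PosDef) (hsz : ℕ → ℝ) (hh0 : ∀ j, 0 ≤ hsz j)
    (htr : ∀ j, ((S j * ((S j)⁻¹ - (S (j + 1))⁻¹)) * (S j * ((S j)⁻¹ - (S (j + 1))⁻¹))).trace ≤ hsz j ^ 2)
    {p q : ℝ} (hpq : p.HolderConjugate q) (hhq : ∀ j, hsz j ≤ 1 / (4 * q))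
    {F : Type*} [NormedAddCommGroup F] [NormedSpace ℝ F] [CompleteSpace F]
    {H : EuclideanSpace ℝ ι → F} (hH : ∀ j, MemLp H (ENNReal.ofReal p) (multivariateGaussian 0 (S j)))
    {Np : ℝ} (hNp : ∀ j, (∫ y, ‖H y‖ ^ p ∂(multivariateGaussian 0 (S j))) ^ (1 / p) ≤ Np) (m : ℕ) :
    ‖∫ y, H y ∂(multivariateGaussian 0 (S m)) - ∫ y, H y ∂(multivariateGaussian 0 (S 0))‖ ≤
      8 * q * (∑ j ∈ Finset.range m, hsz j) * Np := by
  have hp1 : 1 < p := hpq.lt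
  have hq0 : 0 < q := by linarith [hpq.symm.lt]
  have hNp0 : 0 ≤ Np := (Real.rpow_nonneg (integral_nonneg fun y => by positivity) _).trans (hNp 0)
  have hint : ∀ j, Integrable H (multivariateGaussian 0 (S j)) := fun j =>
    (hH j).integrable (by rw [← ENNReal.ofReal_one]; exact ENNReal.ofReal_le_ofReal hp1.le)
  induction m with
  | zero => simp only [sub_self, norm_zero, Finset.range_zero, Finset.sum_empty, mul_zero, zero_mul, le_refl]
  | succ m ih =>
    have hstep := norm_integral_multivariateGaussian_sub_le_of_trace (hS m) (hS (m + 1)) (hh0 m) (htr m)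
      hpq (hhq m) (hH m) (hint (m + 1))
    have hstep' : ‖∫ y, H y ∂(multivariateGaussian 0 (S (m + 1))) - ∫ y, H y ∂(multivariateGaussian 0 (S m))‖
        ≤ 8 * q * hsz m * Np :=
      hstep.trans (mul_le_mul_of_nonneg_left (hNp m) (by have := hh0 m; positivity))
    calc ‖∫ y, H y ∂(multivariateGaussian 0 (S (m + 1))) - ∫ y, H y ∂(multivariateGaussian 0 (S 0))‖
        ≤ ‖∫ y, H y ∂(multivariateGaussian 0 (S (m + 1))) - ∫ y, H y ∂(multivariateGaussian 0 (S m))‖ +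
          ‖∫ y, H y ∂(multivariateGaussian 0 (S m)) - ∫ y, H y ∂(multivariateGaussian 0 (S 0))‖ :=
          norm_sub_le_norm_sub_add_norm_sub _ _ _
      _ ≤ 8 * q * hsz m * Np + 8 * q * (∑ j ∈ Finset.range m, hsz j) * Np := add_le_add hstep' ih
      _ = 8 * q * (∑ j ∈ Finset.range (m + 1), hsz j) * Np := by
          rw [Finset.sum_range_succ]; ring

end Literature.MathematicalPhysics.QuantumFieldTheory

end
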